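import Mathlib
import HarnessLib
import Summits.ResolutionOfSingularities.ResolutionOfSingularities.Theorems.WildQuotientsWildQuotientResolutionS1aCentreAway
import Summits.ResolutionOfSingularities.ResolutionOfSingularities.Theorems.WildQuotientsWildQuotientResolutionS1aChartRingSigma

/-!
# S1a — THE COBORDANT ALGEBRA LOCALISES (ring level, part 1 of the kill-clause transfer)

[OURS · L1 W4.5c · lead-1 g8; infrastructure for `PrincipalCentreChartShrink` (support form) / `KillableAtOfIdle` / (A3)] — NOT statements of
the manuscript; counted 0; AI-level work, weaker than expert review. Crux stmt-ResolutionOfSingularities-17941, line `s1a-logminvertex` v6.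
Pure commutative algebra, route-independent.

For a node `(B, 𝒜, σ)` with centre `(f, w)`, `h ∈ 𝒜 0` `σ`-invariant, `B' = B[h⁻¹]`, `f' = f/1`, `σ' = sigmaAway σ`:
* `cobordantMap f w h : R^w(B) →+* R^w(B')` (base change of Laurent polynomials) with pins; **`isLocalization_away_cobordantMap`**:
  `R^w(B') = R^w(B)[h⁻¹]` (from Literature `IdealFiltration.isLocalization_away_extendedRees`, Włodarczyk Def. 5.1.1 quasi-coherence,
  read on `cobordantAlgebra` through `cobordantAlgebra_eq_extendedRees`); `cobordantMap_sigmaR` (`σ_R`-equivariance);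
* `isLocalization_away_zero` — `(B')₀ = B₀[h⁻¹]` through `CentreAway.zeroToAwayZero`; `exists_of_mem_map_zeroToAwayZero` (normal form
  `y/1 · h⁻ᵏ` of the elements of an extended ideal);
* `exists_invariant_of_mem_traceFiltration_away` — a `σ'`-invariant `β ∈ K_n(B')` is `β₀/hᵏ` with `β₀ ∈ K_n(B)` `σ`-INVARIANT;
* `map_augmentationIdeal_of_semiconj`, `isPrincipal_augmentationIdeal_of_semiconj` — augmentation ideals (and their principality)
  transport along equivariant ring isomorphisms.
-/

set_option linter.dupNamespace false

noncomputable section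

open DirectSum Literature.AlgebraicGeometry.Resolution
open scoped LaurentPolynomial
open Summit.ResolutionOfSingularities.ResolutionOfSingularities.Theorems.WildQuotientResolution.S1.GradedLocalization
open Summit.ResolutionOfSingularities.ResolutionOfSingularities.Theorems.WildQuotientResolution.S1.NodeAway
open Summit.ResolutionOfSingularities.ResolutionOfSingularities.Theorems.WildQuotientResolution.S1.CoarseChart
open Summit.ResolutionOfSingularities.ResolutionOfSingularities.Theorems.WildQuotientResolution.S1.CentreAway

namespace Summit.ResolutionOfSingularities.ResolutionOfSingularities.Theorems.WildQuotientResolution.S1.PrincipalAway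

universe u v

/-! ## Base change of the cobordant algebra -/

section CobordantMap

variable {B : Type u} [CommRing B] {c : ℕ} (f : Fin c → B) (w : Fin c → ℕ) (h : B)

/-- Coefficientwise `x ↦ x/1` on Laurent polynomials: `C b Tⁿ ↦ C (b/1) Tⁿ`. -/
theorem mapRingHom_C_mul_T {A A' : Type*} [CommRing A] [CommRing A'] (φ : A →+* A') (b : A) (n : ℤ) :
    AddMonoidAlgebra.mapRingHom ℤ φ (LaurentPolynomial.C b * LaurentPolynomial.T n) = LaurentPolynomial.C (φ b) * LaurentPolynomial.T n := by
  rw [← LaurentPolynomial.single_eq_C_mul_T, ← LaurentPolynomial.single_eq_C_mul_T, AddMonoidAlgebra.mapRingHom_single]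

/-- Base change maps `R^w(B)` into `R^w(B[h⁻¹])`. -/
theorem mapRingHom_mem_cobordantAlgebra {x : B[T;T⁻¹]} (hx : x ∈ cobordantAlgebra f w) :
    AddMonoidAlgebra.mapRingHom ℤ (algebraMap B (Localization.Away h)) x ∈
      cobordantAlgebra (algebraMap B (Localization.Away h) ∘ f) w := by
  rw [cobordantAlgebra_eq_extendedRees] at hx ⊢
  exact IdealFiltration.mapRingHom_mem_extendedRees _ _ (fun n => (map_weightedFiltration_ideal _ f w n).le) hx

/-- **`R^w(B) → R^w(B[h⁻¹])`**, the base change of the cobordant algebra. [OURS · L1 W4.5c] -/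
def cobordantMap : ↥(cobordantAlgebra f w) →+* ↥(cobordantAlgebra (algebraMap B (Localization.Away h) ∘ f) w) :=
  (AddMonoidAlgebra.mapRingHom ℤ (algebraMap B (Localization.Away h))).restrict _ _ fun _ hx =>
    mapRingHom_mem_cobordantAlgebra f w h hx

/-- Underlying Laurent polynomial of `cobordantMap x`. -/
@[simp] theorem coe_cobordantMap (x : ↥(cobordantAlgebra f w)) :
    ((cobordantMap f w h x : ↥(cobordantAlgebra (algebraMap B (Localization.Away h) ∘ f) w)) : (Localization.Away h)[T;T⁻¹]) =
      AddMonoidAlgebra.mapRingHom ℤ (algebraMap B (Localization.Away h)) x :=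
  rfl

/-- Pin: `cobordantMap (C b) = C (b/1)`. -/
theorem cobordantMap_algebraMap (b : B) :
    cobordantMap f w h (algebraMap B _ b) = algebraMap (Localization.Away h) _ (algebraMap B (Localization.Away h) b) := by
  refine Subtype.ext ?_
  rw [coe_cobordantMap, cobordantAlgebra.coe_algebraMap, cobordantAlgebra.coe_algebraMap]
  have := mapRingHom_C_mul_T (algebraMap B (Localization.Away h)) b 0
  rw [LaurentPolynomial.T_zero, LaurentPolynomial.T_zero, mul_one, mul_one] at this
  exact this

/-- **`R^w(B[h⁻¹]) = R^w(B)[h⁻¹]`** (through `cobordantMap`): Literature `IdealFiltration.isLocalization_away_extendedRees` read on the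
cobordant algebras via `cobordantAlgebra_eq_extendedRees`. [OURS · L1 W4.5c] -/
theorem isLocalization_away_cobordantMap :
    letI := (cobordantMap f w h).toAlgebra
    IsLocalization.Away (algebraMap B (↥(cobordantAlgebra f w)) h) (↥(cobordantAlgebra (algebraMap B (Localization.Away h) ∘ f) w)) := by
  letI := (cobordantMap f w h).toAlgebra
  set F := weightedFiltration f w with hF
  set F' := weightedFiltration (algebraMap B (Localization.Away h) ∘ f) w with hF'
  have heq : ∀ n, F'.ideal n = (F.ideal n).map (algebraMap B (Localization.Away h)) := fun n =>
    (map_weightedFiltration_ideal (algebraMap B (Localization.Away h)) f w n).symm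
  have hle : ∀ n, (F.ideal n).map (algebraMap B (Localization.Away h)) ≤ F'.ideal n := fun n => (heq n).ge
  letI algE : Algebra F.extendedRees F'.extendedRees := (F.extendedReesMap F' hle).toAlgebra
  haveI key : IsLocalization.Away (algebraMap B F.extendedRees h) F'.extendedRees := F.isLocalization_away_extendedRees F' h heq
  have hR : cobordantAlgebra f w = F.extendedRees := cobordantAlgebra_eq_extendedRees f w
  have hR' : cobordantAlgebra (algebraMap B (Localization.Away h) ∘ f) w = F'.extendedRees := cobordantAlgebra_eq_extendedRees _ w
  have halgE : ∀ p : F.extendedRees, ((algebraMap F.extendedRees F'.extendedRees p : F'.extendedRees) : (Localization.Away h)[T;T⁻¹]) =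
      AddMonoidAlgebra.mapRingHom ℤ (algebraMap B (Localization.Away h)) p := fun _ => rfl
  have halg : ∀ p : ↥(cobordantAlgebra f w), ((algebraMap _ (↥(cobordantAlgebra (algebraMap B (Localization.Away h) ∘ f) w)) p :
      ↥(cobordantAlgebra _ w)) : (Localization.Away h)[T;T⁻¹]) = AddMonoidAlgebra.mapRingHom ℤ (algebraMap B (Localization.Away h)) p :=
    fun _ => rfl
  refine IsLocalization.Away.mk _ ?_ ?_ ?_
  · -- `h` becomes a unit
    have : algebraMap (↥(cobordantAlgebra f w)) (↥(cobordantAlgebra (algebraMap B (Localization.Away h) ∘ f) w))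
        (algebraMap B (↥(cobordantAlgebra f w)) h) =
        algebraMap (Localization.Away h) _ (algebraMap B (Localization.Away h) h) := cobordantMap_algebraMap f w h h
    rw [this]
    exact (IsLocalization.Away.algebraMap_isUnit h).map _
  · -- surjectivity up to powers of `h`
    intro z
    let zE : F'.extendedRees := ⟨z.1, by rw [← hR']; exact z.2⟩
    obtain ⟨n, a, ha⟩ := IsLocalization.Away.surj (algebraMap B F.extendedRees h) zE
    refine ⟨n, ⟨a.1, by rw [hR]; exact a.2⟩, Subtype.ext ?_⟩
    have := congrArg Subtype.val ha
    simp only [MulMemClass.coe_mul, SubmonoidClass.coe_pow, halgE, Subalgebra.coe_algebraMap] at this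
    rw [MulMemClass.coe_mul, SubmonoidClass.coe_pow, halg, halg, Subalgebra.coe_algebraMap]
    exact this
  · -- the kernel is `h`-torsion
    intro a b hab
    let aE : F.extendedRees := ⟨a.1, by rw [← hR]; exact a.2⟩
    let bE : F.extendedRees := ⟨b.1, by rw [← hR]; exact b.2⟩
    have habE : algebraMap F.extendedRees F'.extendedRees aE = algebraMap F.extendedRees F'.extendedRees bE := by
      apply Subtype.ext
      rw [halgE, halgE]
      have := congrArg Subtype.val hab
      rwa [halg, halg] at this
    obtain ⟨n, hn⟩ := IsLocalization.Away.exists_of_eq (S := F'.extendedRees) (algebraMap B F.extendedRees h) habE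
    refine ⟨n, Subtype.ext ?_⟩
    have := congrArg Subtype.val hn
    simp only [MulMemClass.coe_mul, SubmonoidClass.coe_pow, Subalgebra.coe_algebraMap] at this
    rw [MulMemClass.coe_mul, MulMemClass.coe_mul, SubmonoidClass.coe_pow, Subalgebra.coe_algebraMap]
    exact this

variable (σ : B ≃+* B) (hσJ : ∀ n : ℕ, ((weightedFiltration f w).ideal n).map (σ : B →+* B) ≤ (weightedFiltration f w).ideal n)
  {p : ℕ} (hp : 0 < p) (hσp : ∀ x : B, (⇑σ)^[p] x = x) (hσh : σ h = h)

/-- **`cobordantMap` is `σ_R`-equivariant**: `σ'_R ∘ base change = base change ∘ σ_R`. [OURS · L1 W4.5c] -/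
theorem cobordantMap_sigmaR (x : ↥(cobordantAlgebra f w)) :
    cobordantMap f w h (sigmaR σ f w hσJ hp hσp x) =
      sigmaR (sigmaAway σ hσh) (algebraMap B (Localization.Away h) ∘ f) w
        (map_sigmaAway_weightedFiltration_le f w σ hσh hσJ) hp (sigmaAway_iterate_eq_self σ hσh hσp) (cobordantMap f w h x) := by
  refine Subtype.ext ?_
  rw [coe_cobordantMap, coe_sigmaR, coe_sigmaR, coe_cobordantMap]
  apply AddMonoidAlgebra.coeff_injective
  ext m
  rw [AddMonoidAlgebra.coeff_mapRingHom, coeff_sigmaT, coeff_sigmaT, AddMonoidAlgebra.coeff_mapRingHom,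
    sigmaAway_algebraMap]

end CobordantMap

/-! ## `(B[h⁻¹])₀` is the localisation of `B₀` at `h` -/

section ZeroLoc

variable {ι : Type v} [AddCommGroup ι] [DecidableEq ι] {B : Type u} [CommRing B] (𝒜 : ι → AddSubgroup B) [GradedRing 𝒜]
  {h : B} (hh : h ∈ 𝒜 0)

/-- **`(B[h⁻¹])₀ = B₀[h⁻¹]`** as a localisation through `zeroToAwayZero` (`NodeAway.awayZeroEquiv` with `e = id`). [OURS · L1 W4.5c] -/
theorem isLocalization_away_zero :
    letI := locGradedRing 𝒜 hh
    letI := (zeroToAwayZero 𝒜 hh).toAlgebra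
    IsLocalization.Away (⟨h, hh⟩ : ↥(𝒜 0)) ↥(locPiece 𝒜 hh 0) := by
  letI := locGradedRing 𝒜 hh
  letI : Algebra ↥(𝒜 0) ↥(locPiece 𝒜 hh 0) := (zeroToAwayZero 𝒜 hh).toAlgebra
  refine IsLocalization.isLocalization_of_algEquiv (Submonoid.powers (⟨h, hh⟩ : ↥(𝒜 0)))
    (AlgEquiv.ofRingEquiv (f := awayZeroEquiv 𝒜 (RingEquiv.refl ↥(𝒜 0)) ⟨h, hh⟩) fun x => Subtype.ext ?_)
  exact coe_awayZeroEquiv_algebraMap 𝒜 (RingEquiv.refl ↥(𝒜 0)) ⟨h, hh⟩ x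

/-- `h/1 · h⁻¹ = 1` in `(B[h⁻¹])₀`. -/
theorem zeroToAwayZero_mul_invSelfZero :
    letI := locGradedRing 𝒜 hh
    zeroToAwayZero 𝒜 hh ⟨h, hh⟩ * invSelfZero 𝒜 hh = 1 := by
  letI := locGradedRing 𝒜 hh
  apply Subtype.ext
  change algebraMap B (Localization.Away h) h * IsLocalization.Away.invSelf h = 1
  exact IsLocalization.Away.mul_invSelf h

/-- Normal form of the elements of an extended ideal `I · (B[h⁻¹])₀`: `y/1 · (h⁻¹)ᵏ` with `y ∈ I`. -/
theorem exists_of_mem_map_zeroToAwayZero {I : Ideal ↥(𝒜 0)} {β : letI := locGradedRing 𝒜 hh; ↥(locPiece 𝒜 hh 0)}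
    (hβ : letI := locGradedRing 𝒜 hh; β ∈ I.map (zeroToAwayZero 𝒜 hh)) :
    letI := locGradedRing 𝒜 hh
    ∃ (k : ℕ) (y : ↥(𝒜 0)), y ∈ I ∧ β = zeroToAwayZero 𝒜 hh y * invSelfZero 𝒜 hh ^ k := by
  letI := locGradedRing 𝒜 hh
  letI : Algebra ↥(𝒜 0) ↥(locPiece 𝒜 hh 0) := (zeroToAwayZero 𝒜 hh).toAlgebra
  haveI := isLocalization_away_zero 𝒜 hh
  obtain ⟨⟨⟨y, hy⟩, ⟨_, k, rfl⟩⟩, hyk⟩ :=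
    (IsLocalization.mem_map_algebraMap_iff (Submonoid.powers (⟨h, hh⟩ : ↥(𝒜 0))) ↥(locPiece 𝒜 hh 0)).mp hβ
  refine ⟨k, y, hy, ?_⟩
  change β * zeroToAwayZero 𝒜 hh (⟨h, hh⟩ ^ k) = zeroToAwayZero 𝒜 hh y at hyk
  have hu : zeroToAwayZero 𝒜 hh (⟨h, hh⟩ ^ k) * invSelfZero 𝒜 hh ^ k = 1 := by
    rw [map_pow, ← mul_pow, zeroToAwayZero_mul_invSelfZero, one_pow]
  calc β = β * (zeroToAwayZero 𝒜 hh (⟨h, hh⟩ ^ k) * invSelfZero 𝒜 hh ^ k) := by rw [hu, mul_one]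
    _ = zeroToAwayZero 𝒜 hh y * invSelfZero 𝒜 hh ^ k := by rw [← mul_assoc, hyk]

end ZeroLoc

/-! ## Invariant normal form of the cover elements of the localised node -/

section NormalForm

variable {ι : Type v} [AddCommGroup ι] [DecidableEq ι] {B : Type u} [CommRing B] (𝒜 : ι → AddSubgroup B) [GradedRing 𝒜]
  {h : B} (hh : h ∈ 𝒜 0) {c : ℕ} (f : Fin c → B) (w : Fin c → ℕ) (σ : B ≃+* B) (hσh : σ h = h)

/-- **Normal form**: a `σ'`-invariant element of `K_n(B[h⁻¹])` is `β₀/hᵏ` with `β₀ ∈ K_n(B)` `σ`-invariant. [OURS · L1 W4.5c] -/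
theorem exists_invariant_of_mem_traceFiltration_away {n : ℕ} (β : letI := locGradedRing 𝒜 hh; ↥(locPiece 𝒜 hh 0))
    (hβ : letI := locGradedRing 𝒜 hh; β ∈ (traceFiltration (locPiece 𝒜 hh) (algebraMap B (Localization.Away h) ∘ f) w).ideal n)
    (hσβ : sigmaAway σ hσh (β : Localization.Away h) = β) :
    letI := locGradedRing 𝒜 hh
    ∃ (k : ℕ) (β₀ : ↥(𝒜 0)), β₀ ∈ (traceFiltration 𝒜 f w).ideal n ∧ σ (β₀ : B) = β₀ ∧
      β = zeroToAwayZero 𝒜 hh β₀ * invSelfZero 𝒜 hh ^ k := by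
  letI := locGradedRing 𝒜 hh
  rw [traceFiltration_away] at hβ
  obtain ⟨k, y, hy, rfl⟩ := exists_of_mem_map_zeroToAwayZero 𝒜 hh hβ
  -- invariance: `σ y / h^k = y / h^k`, so `h^t σ y = h^t y` for some `t`
  have h1 : algebraMap B (Localization.Away h) (σ (y : B)) = algebraMap B (Localization.Away h) (y : B) := by
    have e1 : sigmaAway σ hσh (((zeroToAwayZero 𝒜 hh y * invSelfZero 𝒜 hh ^ k : ↥(locPiece 𝒜 hh 0)) : Localization.Away h)) =
        algebraMap B (Localization.Away h) (σ (y : B)) * IsLocalization.Away.invSelf h ^ k := sigmaAway_mk σ hσh (y : B) k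
    rw [hσβ] at e1
    change algebraMap B (Localization.Away h) (y : B) * IsLocalization.Away.invSelf h ^ k = _ at e1
    have hunit : IsUnit (IsLocalization.Away.invSelf h ^ k) :=
      (IsUnit.of_mul_eq_one_right _ (IsLocalization.Away.mul_invSelf (S := Localization.Away h) h)).pow k
    exact (hunit.mul_left_injective e1).symm
  obtain ⟨⟨_, t, rfl⟩, ht⟩ := IsLocalization.exists_of_eq (M := Submonoid.powers h) h1
  change h ^ t * σ (y : B) = h ^ t * (y : B) at ht
  have hy0 : h ^ t * (y : B) ∈ 𝒜 0 := by
    have := SetLike.mul_mem_graded (SetLike.pow_mem_graded t hh) y.2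
    rwa [nsmul_zero, zero_add] at this
  refine ⟨k + t, ⟨h ^ t * (y : B), hy0⟩, ?_, ?_, ?_⟩
  · -- still in `K_n`
    have : (⟨h ^ t * (y : B), hy0⟩ : ↥(𝒜 0)) = ⟨h, hh⟩ ^ t * y := Subtype.ext (by rw [SetLike.GradeZero.coe_mul, SetLike.GradeZero.coe_pow])
    rw [this]
    exact Ideal.mul_mem_left _ _ hy
  · -- invariant
    change σ (h ^ t * (y : B)) = h ^ t * (y : B)
    rw [map_mul, map_pow, hσh, ht]
  · -- the same fraction
    apply Subtype.ext
    change algebraMap B (Localization.Away h) (y : B) * IsLocalization.Away.invSelf h ^ k =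
      algebraMap B (Localization.Away h) (h ^ t * (y : B)) * IsLocalization.Away.invSelf h ^ (k + t)
    rw [mul_comm (h ^ t) (y : B)]
    exact algebraMap_mul_invSelf_pow_eq (y : B) k t

end NormalForm

/-! ## Equivariant ring isos transport principal augmentation ideals -/

section Semiconj

variable {C C' : Type*} [CommRing C] [CommRing C']

/-- The augmentation ideal is transported by an equivariant ring iso. -/
theorem map_augmentationIdeal_of_semiconj (Θ : C ≃+* C') (τ : C ≃+* C) (τ' : C' ≃+* C') (hΘ : ∀ x, Θ (τ x) = τ' (Θ x)) :
    (augmentationIdeal τ).map (Θ : C →+* C') = augmentationIdeal τ' := by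
  apply le_antisymm
  · rw [augmentationIdeal, Ideal.map_span, Ideal.span_le]
    rintro _ ⟨_, ⟨x, rfl⟩, rfl⟩
    change (Θ : C →+* C') (τ x - x) ∈ augmentationIdeal τ'
    rw [RingHom.coe_coe, map_sub, hΘ]
    exact sub_mem_augmentationIdeal τ' (Θ x)
  · rw [augmentationIdeal, Ideal.span_le]
    rintro _ ⟨y, rfl⟩
    obtain ⟨x, rfl⟩ := Θ.surjective y
    change τ' (Θ x) - Θ x ∈ (augmentationIdeal τ).map (Θ : C →+* C')
    rw [← hΘ, ← map_sub]
    exact Ideal.mem_map_of_mem (Θ : C →+* C') (sub_mem_augmentationIdeal τ x)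

/-- **Principality of the augmentation ideal transports along equivariant ring isos.** [OURS · L1 W4.5c] -/
theorem isPrincipal_augmentationIdeal_of_semiconj (Θ : C ≃+* C') (τ : C ≃+* C) (τ' : C' ≃+* C') (hΘ : ∀ x, Θ (τ x) = τ' (Θ x))
    (hI : (augmentationIdeal τ).IsPrincipal) : (augmentationIdeal τ').IsPrincipal := by
  obtain ⟨ν, hν⟩ := hI
  rw [← map_augmentationIdeal_of_semiconj Θ τ τ' hΘ, hν]
  refine ⟨⟨Θ ν, ?_⟩⟩
  change Ideal.map _ (Ideal.span {ν}) = Ideal.span {Θ ν}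
  rw [Ideal.map_span, Set.image_singleton]
  rfl

end Semiconj

end Summit.ResolutionOfSingularities.ResolutionOfSingularities.Theorems.WildQuotientResolution.S1.PrincipalAway

end
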